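import Summits.ResolutionOfSingularities.ResolutionOfSingularities.Theorems.UltraWalkCert
import Literature.AlgebraicGeometry.Resolution.AdditiveFormsStructure
import HarnessLib

/-!
# HilbertStall — classes: the Hilbert–Samuel STALL INDEX of an ideal at the origin

Node «HilbertStall» (decomp-res lens-3, g31) on the door `UltraWalk.BoundedIsolation` (uniform isolation-certificate
bounds).  The ONE translation of the node: an isolation certificate `g · x_l^N ∈ J` (`g(0) ≠ 0`) of bounded size EXISTS
iff the Hilbert–Samuel function of `K[x]/J` at the origin STALLS at a bounded index,
`𝔪^k ≤ J + 𝔪^(k+1)` (`𝔪 = (x_i : i)` = `MvPolynomial.idealOfVars`).  This file carries the vocabulary and the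
easy direction:

* `lowPart k p` (the terms of degree `≤ k`) and its 𝔪-adic bookkeeping;
* `IdealStall J k`, `Stall q F k := IdealStall (topIdeal q F) k`, `IdealIsolated J` (`IsolatedTop q F` is
  `IdealIsolated (topIdeal q F)` by `Iff.rfl`), `mons σ k` (exponents of degree `k`), `stallSize`;
* monotonicity in the ideal and in the index (a stall propagates upward);
* `idealStall_of_cert` — an isolation certificate with exponent `N` forces a stall at index `card σ · N`
  (pigeonhole on exponents), hence `stall_of_isolatedTopCert`, `exists_stall_of_isolatedTop`;
* `topIdeal_eq_span_range` (the top ideal as the span of a `Fintype`-indexed family) and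
  `totalDegree_hasseDeriv_le` (Hasse derivatives do not raise the total degree);
* `exists_le_degree_eq` / `floor` (below every exponent of degree `≥ k` sits one of degree exactly `k`).

All statements are hypothesis-free kernel theorems over an arbitrary field (commutative ring where division is not
used).  Sources: AtiyahMacdonald1969 (Prop. 2.4, Cor. 2.5: the determinant trick behind the node), Matsumura1987 §14
(Hilbert–Samuel functions, systems of parameters), vandenDriesSchmidt1984 §1 (uniform bounds in polynomial rings over
fields — the door's programme).
-/

set_option linter.dupNamespace false

noncomputable section

open MvPolynomial
open Literature.AlgebraicGeometry.Resolution
open Summit.ResolutionOfSingularities.ResolutionOfSingularities.Theorems.TightDefectClasses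
open Summit.ResolutionOfSingularities.ResolutionOfSingularities.Theorems.UltraWalk

namespace Summit.ResolutionOfSingularities.ResolutionOfSingularities.Theorems.HilbertStall

/-! ## §1 Exponents: degree-`k` monomials and floors -/

section Exponents

variable {σ : Type}

/-- The exponents of degree EXACTLY `k` (a finite set; its cardinality `μ_k` sizes the determinant trick).
DEFINITION (support). [folklore] -/
def mons (σ : Type) [DecidableEq σ] [Fintype σ] (k : ℕ) : Finset (σ →₀ ℕ) :=
  (dbox σ k).filter fun b => b.degree = k

/-- Membership in `mons`: degree exactly `k`. [folklore] -/
theorem mem_mons_iff [DecidableEq σ] [Fintype σ] {k : ℕ} {b : σ →₀ ℕ} : b ∈ mons σ k ↔ b.degree = k := by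
  rw [mons, Finset.mem_filter]
  exact ⟨fun h => h.2, fun h => ⟨mem_dbox_iff.mpr h.le, h⟩⟩

/-- The pure power exponent `k · e_l` has degree `k`. [folklore] -/
theorem single_mem_mons [DecidableEq σ] [Fintype σ] (l : σ) (k : ℕ) : Finsupp.single l k ∈ mons σ k :=
  mem_mons_iff.mpr (Finsupp.degree_single l k)

/-- The SIZE of the certificate produced from a stall at index `k` for generators of degree `≤ D`:
`μ_k · D + k`. DEFINITION (support). [folklore] -/
def stallSize (σ : Type) [DecidableEq σ] [Fintype σ] (k D : ℕ) : ℕ := (mons σ k).card * D + k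

/-- Below every exponent of degree `≥ k` there is an exponent of degree exactly `k`. [folklore] -/
theorem exists_le_degree_eq : ∀ (n : ℕ) (c : σ →₀ ℕ), c.degree = n → ∀ k, k ≤ n →
    ∃ b : σ →₀ ℕ, b ≤ c ∧ b.degree = k := by
  intro n
  induction n with
  | zero =>
    intro c hc k hk
    exact ⟨c, le_rfl, by rw [hc]; exact (Nat.le_zero.mp hk).symm⟩
  | succ n ih =>
    intro c hc k hk
    rcases Nat.eq_or_lt_of_le hk with h | h
    · exact ⟨c, le_rfl, by rw [hc, h]⟩
    · have hc0 : c ≠ 0 := by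
        intro h0; rw [h0, map_zero] at hc; exact Nat.succ_ne_zero n hc.symm
      obtain ⟨i, hi⟩ := Finsupp.support_nonempty_iff.mpr hc0
      have hle : Finsupp.single i 1 ≤ c :=
        Finsupp.single_le_iff.mpr (Nat.one_le_iff_ne_zero.mpr (Finsupp.mem_support_iff.mp hi))
      set c' := c - Finsupp.single i 1 with hc'
      have hcc : c' + Finsupp.single i 1 = c := tsub_add_cancel_of_le hle
      have hdeg : c'.degree = n := by
        have h1 := congrArg Finsupp.degree hcc
        rw [map_add, Finsupp.degree_single, hc] at h1
        exact Nat.succ_injective h1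
      obtain ⟨b, hb, hbk⟩ := ih c' hdeg k (Nat.lt_succ_iff.mp h)
      exact ⟨b, hb.trans tsub_le_self, hbk⟩

/-- The FLOOR of an exponent at level `k`: a chosen exponent `≤ c` of degree exactly `k` (when `k ≤ |c|`; else `0`).
DEFINITION (support). [folklore] -/
def floor (k : ℕ) (c : σ →₀ ℕ) : σ →₀ ℕ :=
  if h : k ≤ c.degree then (exists_le_degree_eq c.degree c rfl k h).choose else 0

/-- The floor lies below. [folklore] -/
theorem floor_le {k : ℕ} {c : σ →₀ ℕ} (h : k ≤ c.degree) : floor k c ≤ c := by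
  rw [floor, dif_pos h]; exact (exists_le_degree_eq c.degree c rfl k h).choose_spec.1

/-- The floor has degree exactly `k`. [folklore] -/
theorem degree_floor {k : ℕ} {c : σ →₀ ℕ} (h : k ≤ c.degree) : (floor k c).degree = k := by
  rw [floor, dif_pos h]; exact (exists_le_degree_eq c.degree c rfl k h).choose_spec.2

/-- The floor is a degree-`k` exponent. [folklore] -/
theorem floor_mem_mons [DecidableEq σ] [Fintype σ] {k : ℕ} {c : σ →₀ ℕ} (h : k ≤ c.degree) : floor k c ∈ mons σ k :=
  mem_mons_iff.mpr (degree_floor h)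

/-- Degree bookkeeping of the floor: `|c − floor| + k = |c|`. [folklore] -/
theorem degree_sub_floor {k : ℕ} {c : σ →₀ ℕ} (h : k ≤ c.degree) : (c - floor k c).degree + k = c.degree := by
  conv_rhs => rw [← tsub_add_cancel_of_le (floor_le h)]
  rw [map_add, degree_floor h]

/-- PIGEONHOLE on exponents: an exponent of degree `≥ card σ · N` has a coordinate `≥ N`. [folklore] -/
theorem exists_coord_ge [Fintype σ] [Nonempty σ] {b : σ →₀ ℕ} {N : ℕ} (hb : Fintype.card σ * N ≤ b.degree) :
    ∃ l, N ≤ b l := by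
  by_contra h0
  have h : ∀ l, b l < N := fun l => not_le.mp fun hl => h0 ⟨l, hl⟩
  obtain ⟨l₀⟩ := ‹Nonempty σ›
  have hN : 1 ≤ N := Nat.one_le_iff_ne_zero.mpr fun h0 => by have := h l₀; omega
  have hsum : b.degree ≤ Fintype.card σ * (N - 1) := by
    rw [Finsupp.degree_eq_sum]
    calc ∑ i, b i ≤ ∑ _i : σ, (N - 1) := Finset.sum_le_sum fun i _ => Nat.le_sub_one_of_lt (h i)
      _ = Fintype.card σ * (N - 1) := by rw [Finset.sum_const, smul_eq_mul, Finset.card_univ]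
  have hpos : 0 < Fintype.card σ := Fintype.card_pos
  have : Fintype.card σ * N ≤ Fintype.card σ * (N - 1) := hb.trans hsum
  have h2 := Nat.le_of_mul_le_mul_left this hpos
  omega

end Exponents

/-! ## §2 The terms of degree `≤ k` and the 𝔪-adic filtration -/

section Graded

variable {σ : Type} {K : Type} [CommRing K]

/-- The LOW PART `low_k p`: the terms of `p` of degree `≤ k`. DEFINITION (support). [folklore] -/
def lowPart (k : ℕ) (p : MvPolynomial σ K) : MvPolynomial σ K :=
  ∑ c ∈ p.support with c.degree ≤ k, monomial c (coeff c p)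

/-- Coefficients of the low part. [folklore] -/
theorem coeff_lowPart (k : ℕ) (p : MvPolynomial σ K) (c : σ →₀ ℕ) :
    coeff c (lowPart k p) = if c.degree ≤ k then coeff c p else 0 := by
  classical
  rw [lowPart, coeff_sum]
  simp_rw [coeff_monomial]
  rw [Finset.sum_ite_eq']
  by_cases hk : c.degree ≤ k
  · rw [if_pos hk]
    by_cases hc : c ∈ p.support
    · rw [if_pos (Finset.mem_filter.mpr ⟨hc, hk⟩)]
    · have hc' : c ∉ p.support.filter (fun c => c.degree ≤ k) := fun h => hc (Finset.mem_filter.mp h).1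
      rw [if_neg hc', notMem_support_iff.mp hc]
  · have hc' : c ∉ p.support.filter (fun c => c.degree ≤ k) := fun h => hk (Finset.mem_filter.mp h).2
    rw [if_neg hk, if_neg hc']

/-- Coefficients of the HIGH PART `p − low_k p`. [folklore] -/
theorem coeff_sub_lowPart (k : ℕ) (p : MvPolynomial σ K) (c : σ →₀ ℕ) :
    coeff c (p - lowPart k p) = if c.degree ≤ k then 0 else coeff c p := by
  rw [coeff_sub, coeff_lowPart]
  split_ifs <;> simp

/-- Every exponent of the low part has degree `≤ k`. [folklore] -/
theorem degree_le_of_mem_support_lowPart {k : ℕ} {p : MvPolynomial σ K} {c : σ →₀ ℕ}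
    (hc : c ∈ (lowPart k p).support) : c.degree ≤ k := by
  by_contra h
  rw [mem_support_iff, coeff_lowPart, if_neg h] at hc
  exact hc rfl

/-- Every exponent of the low part is an exponent of `p`. [folklore] -/
theorem mem_support_of_mem_support_lowPart {k : ℕ} {p : MvPolynomial σ K} {c : σ →₀ ℕ}
    (hc : c ∈ (lowPart k p).support) : c ∈ p.support := by
  rw [mem_support_iff, coeff_lowPart] at hc
  split_ifs at hc with h
  · exact mem_support_iff.mpr hc
  · exact absurd rfl hc

/-- The low part has total degree `≤ k`. [folklore] -/
theorem totalDegree_lowPart_le (k : ℕ) (p : MvPolynomial σ K) : (lowPart k p).totalDegree ≤ k := by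
  rw [totalDegree]
  refine Finset.sup_le fun c hc => ?_
  have h := degree_le_of_mem_support_lowPart hc
  rwa [Finsupp.degree_apply] at h

/-- The low part has total degree `≤ deg p`. [folklore] -/
theorem totalDegree_lowPart_le_self (k : ℕ) (p : MvPolynomial σ K) : (lowPart k p).totalDegree ≤ p.totalDegree := by
  rw [totalDegree, totalDegree]
  exact Finset.sup_mono fun c hc => mem_support_of_mem_support_lowPart hc

/-- The high part lies in `𝔪^(k+1)`. [folklore] -/
theorem sub_lowPart_mem_pow (k : ℕ) (p : MvPolynomial σ K) :
    p - lowPart k p ∈ idealOfVars σ K ^ (k + 1) := by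
  rw [mem_pow_idealOfVars_iff]
  intro c hc
  rw [mem_support_iff, coeff_sub_lowPart] at hc
  split_ifs at hc with h
  · exact absurd rfl hc
  · exact Nat.succ_le_of_lt (not_le.mp h)

/-- A polynomial with vanishing constant coefficient lies in `𝔪`. [folklore] -/
theorem mem_idealOfVars_of_coeff_zero {p : MvPolynomial σ K} (hp : coeff 0 p = 0) : p ∈ idealOfVars σ K := by
  rw [← pow_one (idealOfVars σ K), mem_pow_idealOfVars_iff]
  intro c hc
  rw [Nat.one_le_iff_ne_zero, ne_eq, Finsupp.degree_eq_zero_iff]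
  rintro rfl
  exact (mem_support_iff.mp hc) hp

/-- A monic monomial of degree `≥ n` lies in `𝔪^n`. [folklore] -/
theorem monomial_mem_pow_of_le {n : ℕ} {b : σ →₀ ℕ} (h : n ≤ b.degree) (r : K) :
    monomial b r ∈ idealOfVars σ K ^ n := by
  classical
  rw [mem_pow_idealOfVars_iff]
  intro c hc
  have := support_monomial_subset hc
  rw [Finset.mem_singleton] at this
  rwa [this]

end Graded

/-! ## §3 Stall, isolation, and the easy direction (certificate ⇒ stall) -/

section Stall

variable {σ : Type} {K : Type} [CommRing K]

/-- **`IdealStall J k`** — the Hilbert–Samuel function of `K[x]/J` at the origin STALLS at index `k`: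
`𝔪^k ≤ J + 𝔪^(k+1)` (equivalently `dim K[x]/(J + 𝔪^k) = dim K[x]/(J + 𝔪^(k+1))`; a finite-dimensional `K`-linear
rank condition in degree `≤ k`).  NEW CLASS (the node's letter).  (Sources: Matsumura1987 §14; AtiyahMacdonald1969 Ch. 11.) -/
def IdealStall (J : Ideal (MvPolynomial σ K)) (k : ℕ) : Prop :=
  idealOfVars σ K ^ k ≤ J ⊔ idealOfVars σ K ^ (k + 1)

/-- **`IdealIsolated J`** — the origin is an ISOLATED point of `V(J)` in the door's certificate sense: some `g` with
`g(0) ≠ 0` multiplies a power of every variable into `J` (`IsolatedTop q F` is literally `IdealIsolated (topIdeal q F)`).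
NEW CLASS (support). (Sources: BierstoneGrigorievMilmanWlodarczyk2011 Def. 3.1.3, as in the tree's `IsolatedTop`.) -/
def IdealIsolated (J : Ideal (MvPolynomial σ K)) : Prop :=
  ∃ (N : ℕ) (g : MvPolynomial σ K), constantCoeff g ≠ 0 ∧ ∀ i : σ, g * X i ^ N ∈ J

/-- Monotonicity of the stall in the ideal. [folklore] -/
theorem idealStall_mono {J J' : Ideal (MvPolynomial σ K)} (h : J ≤ J') {k : ℕ} (hs : IdealStall J k) :
    IdealStall J' k :=
  le_trans hs (sup_le_sup_right h _)

/-- A stall PROPAGATES one step up: `𝔪^k ≤ J + 𝔪^(k+1)` gives `𝔪^(k+1) ≤ J + 𝔪^(k+2)`. [folklore] -/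
theorem idealStall_succ {J : Ideal (MvPolynomial σ K)} {k : ℕ} (hs : IdealStall J k) : IdealStall J (k + 1) := by
  unfold IdealStall at hs ⊢
  calc idealOfVars σ K ^ (k + 1) = idealOfVars σ K * idealOfVars σ K ^ k := pow_succ' _ _
    _ ≤ idealOfVars σ K * (J ⊔ idealOfVars σ K ^ (k + 1)) := Ideal.mul_mono_right hs
    _ = idealOfVars σ K * J ⊔ idealOfVars σ K ^ (k + 1 + 1) := by rw [Ideal.mul_sup, ← pow_succ']
    _ ≤ J ⊔ idealOfVars σ K ^ (k + 1 + 1) := sup_le_sup_right Ideal.mul_le_left _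

/-- A stall propagates upward to every larger index. [folklore] -/
theorem idealStall_mono_index {J : Ideal (MvPolynomial σ K)} {k k' : ℕ} (h : k ≤ k') (hs : IdealStall J k) :
    IdealStall J k' := by
  induction h with
  | refl => exact hs
  | step _ ih => exact idealStall_succ ih

/-- Monotonicity of isolation in the ideal. [folklore] -/
theorem idealIsolated_mono {J J' : Ideal (MvPolynomial σ K)} (h : J ≤ J') (hJ : IdealIsolated J) : IdealIsolated J' := by
  obtain ⟨N, g, hg, hmem⟩ := hJ
  exact ⟨N, g, hg, fun i => h (hmem i)⟩

end Stall

section StallField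

variable {σ : Type} {K : Type} [Field K]

/-- **`Stall q F k`** — the top ideal `J_F = (D^{(a)}F : 0 < |a| < q)` stalls at index `k`. NEW CLASS (the node's letter
on the door's data). (Sources: Matsumura1987 §14.) -/
def Stall (q : ℕ) (F : MvPolynomial σ K) (k : ℕ) : Prop := IdealStall (topIdeal q F) k

/-- DICTIONARY (definitional): the tree's `IsolatedTop q F` is `IdealIsolated (topIdeal q F)`. [folklore] -/
theorem isolatedTop_iff_idealIsolated (q : ℕ) (F : MvPolynomial σ K) :
    IsolatedTop q F ↔ IdealIsolated (topIdeal q F) := Iff.rfl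

/-- Upward propagation of `Stall`. [folklore] -/
theorem stall_mono_index {q : ℕ} {F : MvPolynomial σ K} {k k' : ℕ} (h : k ≤ k') (hs : Stall q F k) : Stall q F k' :=
  idealStall_mono_index h hs

/-- **CERTIFICATE ⇒ STALL (pigeonhole).**  If `g(0) ≠ 0` and `g · x_l^N ∈ J` for every variable, then `J` stalls at
index `card σ · N`: a monomial `x^b` of that degree has a coordinate `b_l ≥ N`, and
`x^b = g(0)⁻¹ · (g · x^b − (g − g(0)) · x^b) ∈ J + 𝔪^(|b|+1)`. [folklore] -/
theorem idealStall_of_cert [Fintype σ] [Nonempty σ] {J : Ideal (MvPolynomial σ K)} {N : ℕ} {g : MvPolynomial σ K}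
    (hg : coeff 0 g ≠ 0) (hmem : ∀ l : σ, g * X l ^ N ∈ J) : IdealStall J (Fintype.card σ * N) := by
  classical
  unfold IdealStall
  rw [pow_idealOfVars_eq_span, Ideal.span_le]
  rintro _ ⟨b, hb, rfl⟩
  have hbdeg : b.degree = Fintype.card σ * N := hb
  obtain ⟨l, hl⟩ := exists_coord_ge (σ := σ) hbdeg.ge
  set b' := b - Finsupp.single l N with hb'
  have hbb : b' + Finsupp.single l N = b := tsub_add_cancel_of_le (Finsupp.single_le_iff.mpr hl)
  have hxb : (monomial b (1 : K)) = monomial b' 1 * X l ^ N := by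
    rw [X_pow_eq_monomial, monomial_mul, hbb, mul_one]
  set I : Ideal (MvPolynomial σ K) := J ⊔ idealOfVars σ K ^ (Fintype.card σ * N + 1) with hI
  -- `A := g · x^b ∈ J`, `B := (g − C g(0)) · x^b ∈ 𝔪^(|b|+1)`
  have hA : g * monomial b (1 : K) ∈ I := by
    rw [hxb, mul_comm (monomial b' (1 : K)), ← mul_assoc]
    exact Ideal.mem_sup_left (Ideal.mul_mem_right _ _ (hmem l))
  have hB : (g - C (coeff 0 g)) * monomial b (1 : K) ∈ I := by
    refine Ideal.mem_sup_right ?_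
    rw [pow_succ']
    refine Ideal.mul_mem_mul (mem_idealOfVars_of_coeff_zero ?_) (monomial_mem_pow_of_le hbdeg.ge 1)
    simp
  have hkey : monomial b (1 : K) = C (coeff 0 g)⁻¹ * (g * monomial b 1 - (g - C (coeff 0 g)) * monomial b 1) := by
    rw [← sub_mul, sub_sub_cancel, ← mul_assoc, ← C_mul, inv_mul_cancel₀ hg, C_1, one_mul]
  show monomial b (1 : K) ∈ I
  rw [hkey]
  exact Ideal.mul_mem_left _ _ (Ideal.sub_mem _ hA hB)

/-- A certified isolated top of size `β` stalls at index `card σ · β`. [folklore] -/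
theorem stall_of_isolatedTopCert [DecidableEq σ] [Fintype σ] [Nonempty σ] {q β : ℕ} {F : MvPolynomial σ K}
    (hc : IsolatedTopCert q β F) : Stall q F (Fintype.card σ * β) := by
  obtain ⟨c⟩ := hc
  have hst : IdealStall (topIdeal q F) (Fintype.card σ * c.N) := by
    refine idealStall_of_cert c.g_zero fun l => ?_
    rw [c.eq l]
    refine Ideal.sum_mem _ fun a ha => Ideal.mul_mem_left _ _ (Ideal.subset_span ⟨a, ?_, rfl⟩)
    exact mem_hasseIndex.mp ha
  exact idealStall_mono_index (Nat.mul_le_mul_left _ c.N_le) hst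

/-- Every isolated top stalls at SOME index (`3N` for three variables). [folklore] -/
theorem exists_stall_of_isolatedTop [Fintype σ] [Nonempty σ] {q : ℕ} {F : MvPolynomial σ K} (h : IsolatedTop q F) :
    ∃ k, Stall q F k := by
  obtain ⟨N, g, hg, hmem⟩ := h
  refine ⟨Fintype.card σ * N, idealStall_of_cert ?_ hmem⟩
  rwa [← constantCoeff_eq]

/-- The top ideal as the span of the `Fintype`-indexed family of Hasse derivatives over `hasseIndex`. [folklore] -/
theorem topIdeal_eq_span_range [DecidableEq σ] [Fintype σ] (q : ℕ) (F : MvPolynomial σ K) :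
    topIdeal q F = Ideal.span (Set.range fun a : ↥(hasseIndex σ q) => hasseDeriv K (a : σ →₀ ℕ) F) := by
  apply le_antisymm
  · refine Ideal.span_le.mpr ?_
    rintro _ ⟨d, hd, rfl⟩
    exact Ideal.subset_span ⟨⟨d, mem_hasseIndex.mpr hd⟩, rfl⟩
  · refine Ideal.span_le.mpr ?_
    rintro _ ⟨a, rfl⟩
    exact Ideal.subset_span ⟨a, mem_hasseIndex.mp a.2, rfl⟩

end StallField

/-! ## §4 Hasse derivatives do not raise the total degree -/

section Degree

variable {σ : Type} {K : Type} [CommRing K]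

/-- `deg D^{(a)}F ≤ deg F` (coefficientwise: `coeff_β D^{(a)}F ≠ 0 ⇒ coeff_{a+β} F ≠ 0`). [folklore] -/
theorem totalDegree_hasseDeriv_le (a : σ →₀ ℕ) (F : MvPolynomial σ K) :
    (hasseDeriv K a F).totalDegree ≤ F.totalDegree := by
  classical
  rw [totalDegree]
  refine Finset.sup_le fun β hβ => ?_
  have hne : coeff (a + β) F ≠ 0 := by
    intro h0
    rw [mem_support_iff, coeff_hasseDeriv, h0, mul_zero] at hβ
    exact hβ rfl
  have h1 : (β.sum fun _ e => e) ≤ ((a + β).sum fun _ e => e) := by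
    have e1 : (β.sum fun _ e => e) = β.degree := by simp [Finsupp.sum, Finsupp.degree_apply]
    have e2 : ((a + β).sum fun _ e => e) = (a + β).degree := by simp [Finsupp.sum, Finsupp.degree_apply]
    rw [e1, e2, map_add]
    exact le_add_self
  exact h1.trans (le_totalDegree (mem_support_iff.mpr hne))

/-- In particular every Hasse derivative of a polynomial of degree `≤ D` has degree `≤ D`. [folklore] -/
theorem totalDegree_hasseDeriv_le_of_le {a : σ →₀ ℕ} {F : MvPolynomial σ K} {D : ℕ} (hF : F.totalDegree ≤ D) :
    (hasseDeriv K a F).totalDegree ≤ D :=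
  (totalDegree_hasseDeriv_le a F).trans hF

end Degree

end Summit.ResolutionOfSingularities.ResolutionOfSingularities.Theorems.HilbertStall

end
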